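import Summits.CriticalPhenomena.PercolationContinuityZ3.Theorems.Transplant.SkelFrmFrom1ReachRadQUV
import Summits.CriticalPhenomena.PercolationContinuityZ3.Theorems.Transplant.SkelFrmFrom1ReachRowsQUVPx
import HarnessLib

/-!
# GEN ROW (RULING D-Us, lead g21 V147b / Us-R1–R3 lead g22; WAVE-Us-MANIFEST v1.0 §3/§9, (C) REACH column level 15) «SkelFrmFrom1ReachRadQUVPx» — the GENERALISED twin of
# «SkelFrmFrom1ReachRadQUV» (U idx 115): **THE (C) RESIDUE AT ONE PROBE OF A RUN, SECOND AXIS `u`-FORM, RADII AND DEPTH DISCHARGED, UNDER PROXIES** (`reachOblAtHNF_frmQ3VR_sndUPx` over «…ReachRowsQUVPx»)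

builds on p205010 (kernel theorem, internal audit signed; external expert review pending) — nothing in this file uses p205010; NOTHING about the OPEN node U_s
(`SamePDropOfSkeletonFrmScaled₁`) is claimed; no statement, no `@[conjecture]`, def-free.  Lane `prim-bschramm`, seat `prim-bschramm-gen-1` g0 (GEN pen, (C) column per
RULING Us-R3); helper file (`--supports stmt-CriticalPhenomena-4575 --as helper`).  GEN HUNKS vs the U twin (WAVE-Us-MANIFEST §2; tool `bin/port_c_px.py`; everything else
BYTE-IDENTICAL — radii at the probe, entrance depth, levels, world rows and the excess device are L-side and stay at `O`/`O.merged`): (i) binder `(h1) ↦ (hP : Φ.HasProxies t D)`,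
`hAt` of the Px choice data `choiceAtQ3VPx … D …` (read back by `atQ3V_of_atQ3VPx` where U lemmas are called); (iv) radii: the KIT quantities — here only the late threshold
`KS0.r₀0 t Dk mk (RL + D)` (in `hρ1`, `hρ3'`, `hr₀R`, `hR₁R`) and the corridor record `R′ := KS0.R'0 κ Φ t p Dk mk` (in `HK`, `hρ2`, the reading rows) — are read at the free
kit record `Dk : DataNS V`, and the pair `(Dk, hΛRgK)` is passed to «SkelFrmFrom1ReachRowsQUVPx» (whose docstring explains the device; K-1: the tops take `Dk := O.merged.bumpR D`).
U is the instance `D = 0`, `Dk = O.merged`.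
[cite: KozmaNitzan2024, §4 Lemma 12 (pp. 23–25), p. 30 (Step IV); pp. 19–21 ((21)–(25))] [cite: BenjaminiSchramm1996, Conj. 4] [this work]
-/

noncomputable section

open MeasureTheory ProbabilityTheory
open scoped ENNReal Classical

namespace Summit.CriticalPhenomena.PercolationContinuityZ3.Theorems.Transplant

namespace PlanarSkeletonFrmFrom

open Literature.Probability.Percolation Literature.Probability.LatticeModels SimpleGraph GadgetSystem ProbeHistory HSiteScheme Contour KNCells
open Literature.Probability.Percolation.KozmaNitzan.Cells (oth sgOf)
open KNCells.KSchA KNLevels ChainPlanar ChainPara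
open Literature.Barriers.CriticalPhenomena (HasExponentialGrowth graphBall graphBall_mono mem_graphBall_self)
open Skel (ReachOblAtHNF excess)
open SkelI (tanOff)
open SkelConc (Consts)
open BoxProdZ2 (ConcRadiiG)
open TwoAxis.Para (modulus)
open Skelφ (oriφ trφ)
open Skelφ.StepI (DataN DataNS OutNS)
open BoxProdZ2 (Erad nQ nS)

namespace NegB

open Neg

section Rad

variable {κ : Consts} {V : Type} [DecidableEq V] [Countable V] {G : SimpleGraph V} [G.LocallyFinite] {Φ : PlanarSkeletonFrmFrom G} {t : V} {p : unitInterval}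
  {hC : Φ.CylSubcritical p} {gv fv : Neg.FSlot} {Pv : PSlot} {ex mx : GSlot} {cv hv : CSlot} {bv : BSlot} {O : OutNS V} {q : unitInterval}

set_option maxHeartbeats 800000 in
/-- [UNDER PROXIES: kit at the kit record `Dk` (hΛRgK), long radius `RL + D`, hAt of the Px data]
**THE (C) RESIDUE OF THE CHOICE FUNCTION OF RECORD AT ONE PROBE OF A RUN, SECOND AXIS, RADII AND DEPTH DISCHARGED** (fibre block `SUS ex mx`):
window radius `R := E(nQ α x) − 3`, entrance depth `R₀ := E(nS α v)` (`deep_of_run₂bOV`), excess radius `R₁ := Rex R₀` (`hR₁_US`), world rows from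
SkelFrmBChoiceRooms with `φe :=` the fine map and `m := 50·rmax` (`fine_diam_le_mRS`); left: the K-G row set + `N`, three `E₀`/`gap` floors, the reading
and start-box rows, the budget. [cite: KozmaNitzan2024, §4 Lemma 12 (pp. 23–25), p. 30 (Step IV)] -/
theorem reachOblAtHNF_frmQ3VR_sndUPx {κ : Consts} {V : Type} [DecidableEq V] [Countable V] {G : SimpleGraph V} [G.LocallyFinite] {Φ : PlanarSkeletonFrmFrom G} {t : V} {p : unitInterval} {hC : Φ.CylSubcritical p} {gv : Neg.FSlot} {fv : Neg.FSlot} {Pv : PSlot} {ex : GSlot} {mx : GSlot} {cv : CSlot} {hv : CSlot} {bv : BSlot} {O : OutNS V} {q : unitInterval} {D : ℕ} (hAt : (choiceAtQ3VPx κ Φ t p D Pv gv fv (SUS ex mx) cv hv bv hC).AtQNQ O q) (hP : Φ.HasProxies t D)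
    (hp0 : 0 < (p : ℝ)) (hp1 : (p : ℝ) < 1) (mk : ℕ)
    -- UNDER PROXIES: the KIT record `Dk` (K-1: the tops take `Dk := O.merged.bumpR D`) and the ONE fact tying it to the zone family `Λ ∘ prox` at `M_u`
    (Dk : DataNS V) (hΛRgK : ∀ c, O.merged.Λ (hP.prox c) (Mu O.merged) ⊆ KS.RgK G t Dk mk (KS.φK Φ t O.D O.DT.toDataN O.ori mk) c)
    -- the probe, ON A RUN, CHOSEN
    {h : ProbeHistory V} {e : Site 2 × MDir} (hrun : (((KSchA.mk (ΓQV κ Φ t p O gv fv (SUS ex mx) cv hv bv q) q κ.δ : KSchA V ℕ))).IsRun₂O G h) (hc : ((((KSchA.mk (ΓQV κ Φ t p O gv fv (SUS ex mx) cv hv bv q) q κ.δ : KSchA V ℕ))).astOf₂O G h).st.ochoice KSchA.qNE = some e)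
    (hV : (((KSchA.mk (ΓQV κ Φ t p O gv fv (SUS ex mx) cv hv bv q) q κ.δ : KSchA V ℕ))).Valid₂O G h e) (hdu : ((((1 : Fin 2), true) : MDir)) ∈ (((KSchA.mk (ΓQV κ Φ t p O gv fv (SUS ex mx) cv hv bv q) q κ.δ : KSchA V ℕ))).onwardO G h (tgt e)) (hne : ((((1 : Fin 2), true) : MDir)) ≠ rev e.2)
    -- the corridor of record
    {ρ qq W : ℕ} (HK : Skelφ.KGYRows (nL κ Φ t p O.merged (gOf κ Φ t p O gv) (fOf κ Φ t p O fv)) (ℓL κ Φ t p O.merged (gOf κ Φ t p O gv) (fOf κ Φ t p O fv)) (hL κ Φ t p O.merged (gOf κ Φ t p O gv) (fOf κ Φ t p O fv)) (vL κ Φ t p O.merged (gOf κ Φ t p O gv) (fOf κ Φ t p O fv)) (KS0.R'0 κ Φ t p Dk mk) ρ qq W) (N : ℕ)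
    -- THE THREE RADIUS FLOORS (ρ1) kit threshold, (ρ2) prism depth, (ρ3) excess inside one gap
    (hρ1 : KS0.r₀0 t Dk mk (RL κ Φ t p O gv fv + D) + 3 ≤ Skelφ.Prm.E₀ (SUS ex mx κ Φ t p O.merged (gOf κ Φ t p O gv) (fOf κ Φ t p O fv) q))
    (hρ2 : (13 : ℤ) * (((N : ℤ) + 1) * (((nL κ Φ t p O.merged (gOf κ Φ t p O gv) (fOf κ Φ t p O fv)) * (ℓL κ Φ t p O.merged (gOf κ Φ t p O gv) (fOf κ Φ t p O fv)) / Skelφ.shearUnit (nL κ Φ t p O.merged (gOf κ Φ t p O gv) (fOf κ Φ t p O fv)) (hL κ Φ t p O.merged (gOf κ Φ t p O gv) (fOf κ Φ t p O fv)) + 1 : ℕ) : ℤ) + Skelφ.kgZY₀ (nL κ Φ t p O.merged (gOf κ Φ t p O gv) (fOf κ Φ t p O fv)) (vL κ Φ t p O.merged (gOf κ Φ t p O gv) (fOf κ Φ t p O fv)) (KS0.R'0 κ Φ t p Dk mk) ρ W N (Skelφ.kgM₁Y (nL κ Φ t p O.merged (gOf κ Φ t p O gv) (fOf κ Φ t p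 O fv)) (vL κ Φ t p O.merged (gOf κ Φ t p O gv) (fOf κ Φ t p O fv)) (KS0.R'0 κ Φ t p Dk mk) ρ W N) (Skelφ.kgWm₂Y (nL κ Φ t p O.merged (gOf κ Φ t p O gv) (fOf κ Φ t p O fv)) (vL κ Φ t p O.merged (gOf κ Φ t p O gv) (fOf κ Φ t p O fv)) (KS0.R'0 κ Φ t p Dk mk) ρ W N) (Skelφ.kgWp₂Y (nL κ Φ t p O.merged (gOf κ Φ t p O gv) (fOf κ Φ t p O fv)) (vL κ Φ t p O.merged (gOf κ Φ t p O gv) (fOf κ Φ t p O fv)) (KS0.R'0 κ Φ t p Dk mk) ρ W N) (Skelφ.kgM₂Y (nL κ Φ t p O.merged (gOf κ Φ t p O gv) (fOf κ Φ t p O fv)) (ℓL κ Φ t p O.merged (gOf κ Φ t p O gv) (fOf κ Φ t p O fv)) (hL κ Φ t p O.merged (gOf κ Φ t p O gv) (fOf κ Φ t p O fv)) (vL κ Φ t p O.merged (gOf κ Φ t p O gv) (fOf κ Φ t p O fv)) (KS0.R'0 κ Φ t p Dk mk) ρ qq W N) + Skelφ.kgZY₁ (nL κ Φ t p O.merged (gOf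 κ Φ t p O gv) (fOf κ Φ t p O fv)) (ℓL κ Φ t p O.merged (gOf κ Φ t p O gv) (fOf κ Φ t p O fv)) (hL κ Φ t p O.merged (gOf κ Φ t p O gv) (fOf κ Φ t p O fv)) (KS0.R'0 κ Φ t p Dk mk) ρ qq N (Skelφ.kgM₁Y (nL κ Φ t p O.merged (gOf κ Φ t p O gv) (fOf κ Φ t p O fv)) (vL κ Φ t p O.merged (gOf κ Φ t p O gv) (fOf κ Φ t p O fv)) (KS0.R'0 κ Φ t p Dk mk) ρ W N) (Skelφ.kgM₂Y (nL κ Φ t p O.merged (gOf κ Φ t p O gv) (fOf κ Φ t p O fv)) (ℓL κ Φ t p O.merged (gOf κ Φ t p O gv) (fOf κ Φ t p O fv)) (hL κ Φ t p O.merged (gOf κ Φ t p O gv) (fOf κ Φ t p O fv)) (vL κ Φ t p O.merged (gOf κ Φ t p O gv) (fOf κ Φ t p O fv)) (KS0.R'0 κ Φ t p Dk mk) ρ qq W N)) + 4 ≤ (Skelφ.Prm.E₀ (SUS ex mx κ Φ t p O.merged (gOf κ Φ t p O gv) (fOf κ Φ t p O fv) q) : ℤ))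
    (hρ3 : ∀ k : ℕ, (SUS ex mx κ Φ t p O.merged (gOf κ Φ t p O gv) (fOf κ Φ t p O fv) q).Rex (Erad (Skelφ.Prm.gap (SUS ex mx κ Φ t p O.merged (gOf κ Φ t p O gv) (fOf κ Φ t p O fv) q)) (fun _ => 0) (Skelφ.Prm.E₀ (SUS ex mx κ Φ t p O.merged (gOf κ Φ t p O gv) (fOf κ Φ t p O fv) q)) k) + KS0.r₀0 t Dk mk (RL κ Φ t p O gv fv + D) + 3 ≤
      Skelφ.Prm.gap (SUS ex mx κ Φ t p O.merged (gOf κ Φ t p O gv) (fOf κ Φ t p O fv) q) (Erad (Skelφ.Prm.gap (SUS ex mx κ Φ t p O.merged (gOf κ Φ t p O gv) (fOf κ Φ t p O fv) q)) (fun _ => 0) (Skelφ.Prm.E₀ (SUS ex mx κ Φ t p O.merged (gOf κ Φ t p O gv) (fOf κ Φ t p O fv) q)) k))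
    -- PER-REGION READING ROWS of the second-axis corridor (J17)
    (hPR : ∀ k ≤ (Skelφ.kgCorrSchedY HK.hn HK.hv HK.hlay (HK.kgYVals_ok₁ N) (HK.kgYVals_ok₂ N) (HK.kgYVals_split N)).N, ∃ lo hi : Site 2,
      (Skelφ.kgCorrSchedY HK.hn HK.hv HK.hlay (HK.kgYVals_ok₁ N) (HK.kgYVals_ok₂ N) (HK.kgYVals_split N)).region k ⊆ Finset.Icc lo hi ∧
      (-(5 * (((fcellsV κ Φ t p O.merged (gOf κ Φ t p O gv) (fOf κ Φ t p O fv) (cOf κ Φ t p O gv fv cv) (hOf κ Φ t p O gv fv hv))).r 1 : ℤ)) + 1 ≤ Skelφ.rdLo ((prFA κ Φ t p O.merged (gOf κ Φ t p O gv) (fOf κ Φ t p O fv))).A (nL κ Φ t p O.merged (gOf κ Φ t p O gv) (fOf κ Φ t p O fv)) (hL κ Φ t p O.merged (gOf κ Φ t p O gv) (fOf κ Φ t p O fv)) (vL κ Φ t p O.merged (gOf κ Φ t p O gv) (fOf κ Φ t p O fv)) (vβL κ Φ t p O.merged (gOf κ Φ t p O gv) (fOf κ Φ t p O fv)) ((prFA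 κ Φ t p O.merged (gOf κ Φ t p O gv) (fOf κ Φ t p O fv))).c₀ ((prFA κ Φ t p O.merged (gOf κ Φ t p O gv) (fOf κ Φ t p O fv))).c₁ ((prFA κ Φ t p O.merged (gOf κ Φ t p O gv) (fOf κ Φ t p O fv))).D lo hi 1 ∧
        Skelφ.rdHi ((prFA κ Φ t p O.merged (gOf κ Φ t p O gv) (fOf κ Φ t p O fv))).A (nL κ Φ t p O.merged (gOf κ Φ t p O gv) (fOf κ Φ t p O fv)) (hL κ Φ t p O.merged (gOf κ Φ t p O gv) (fOf κ Φ t p O fv)) (vL κ Φ t p O.merged (gOf κ Φ t p O gv) (fOf κ Φ t p O fv)) (vβL κ Φ t p O.merged (gOf κ Φ t p O gv) (fOf κ Φ t p O fv)) ((prFA κ Φ t p O.merged (gOf κ Φ t p O gv) (fOf κ Φ t p O fv))).c₀ ((prFA κ Φ t p O.merged (gOf κ Φ t p O gv) (fOf κ Φ t p O fv))).c₁ ((prFA κ Φ t p O.merged (gOf κ Φ t p O gv) (fOf κ Φ t p O fv))).D lo hi 1 ≤ 22 * (((fcellsV κ Φ t p O.merged (gOf κ Φ t p O gv) (fOf κ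 Φ t p O fv) (cOf κ Φ t p O gv fv cv) (hOf κ Φ t p O gv fv hv))).r 1 : ℤ) - 1) ∧
      (-(((fcellsV κ Φ t p O.merged (gOf κ Φ t p O gv) (fOf κ Φ t p O fv) (cOf κ Φ t p O gv fv cv) (hOf κ Φ t p O gv fv hv))).hB 1 : ℤ) + 1 ≤ Skelφ.rdLo ((prFA κ Φ t p O.merged (gOf κ Φ t p O gv) (fOf κ Φ t p O fv))).A (nL κ Φ t p O.merged (gOf κ Φ t p O gv) (fOf κ Φ t p O fv)) (hL κ Φ t p O.merged (gOf κ Φ t p O gv) (fOf κ Φ t p O fv)) (vL κ Φ t p O.merged (gOf κ Φ t p O gv) (fOf κ Φ t p O fv)) (vβL κ Φ t p O.merged (gOf κ Φ t p O gv) (fOf κ Φ t p O fv)) ((prFA κ Φ t p O.merged (gOf κ Φ t p O gv) (fOf κ Φ t p O fv))).c₀ ((prFA κ Φ t p O.merged (gOf κ Φ t p O gv) (fOf κ Φ t p O fv))).c₁ ((prFA κ Φ t p O.merged (gOf κ Φ t p O gv) (fOf κ Φ t p O fv))).D lo hi 0 ∧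
        Skelφ.rdHi ((prFA κ Φ t p O.merged (gOf κ Φ t p O gv) (fOf κ Φ t p O fv))).A (nL κ Φ t p O.merged (gOf κ Φ t p O gv) (fOf κ Φ t p O fv)) (hL κ Φ t p O.merged (gOf κ Φ t p O gv) (fOf κ Φ t p O fv)) (vL κ Φ t p O.merged (gOf κ Φ t p O gv) (fOf κ Φ t p O fv)) (vβL κ Φ t p O.merged (gOf κ Φ t p O gv) (fOf κ Φ t p O fv)) ((prFA κ Φ t p O.merged (gOf κ Φ t p O gv) (fOf κ Φ t p O fv))).c₀ ((prFA κ Φ t p O.merged (gOf κ Φ t p O gv) (fOf κ Φ t p O fv))).c₁ ((prFA κ Φ t p O.merged (gOf κ Φ t p O gv) (fOf κ Φ t p O fv))).D lo hi 0 ≤ (((fcellsV κ Φ t p O.merged (gOf κ Φ t p O gv) (fOf κ Φ t p O fv) (cOf κ Φ t p O gv fv cv) (hOf κ Φ t p O gv fv hv))).hF 1 : ℤ) - 1))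
    -- READING ROWS of the arrival box `[kgLastLoY, kgLastHiY]` (SkelPhiCorridorKGBoxes)
    (hLl : 20 * (((fcellsV κ Φ t p O.merged (gOf κ Φ t p O gv) (fOf κ Φ t p O fv) (cOf κ Φ t p O gv fv cv) (hOf κ Φ t p O gv fv hv))).r 1 : ℤ) - (bOf κ Φ t p O gv fv bv) 1 + 1 ≤ Skelφ.rdLo ((prFA κ Φ t p O.merged (gOf κ Φ t p O gv) (fOf κ Φ t p O fv))).A (nL κ Φ t p O.merged (gOf κ Φ t p O gv) (fOf κ Φ t p O fv)) (hL κ Φ t p O.merged (gOf κ Φ t p O gv) (fOf κ Φ t p O fv)) (vL κ Φ t p O.merged (gOf κ Φ t p O gv) (fOf κ Φ t p O fv)) (vβL κ Φ t p O.merged (gOf κ Φ t p O gv) (fOf κ Φ t p O fv)) ((prFA κ Φ t p O.merged (gOf κ Φ t p O gv) (fOf κ Φ t p O fv))).c₀ ((prFA κ Φ t p O.merged (gOf κ Φ t p O gv) (fOf κ Φ t p O fv))).c₁ ((prFA κ Φ t p O.merged (gOf κ Φ t p O gv) (fOf κ Φ t p O fv))).D (HK.kgLastLoY N) (HK.kgLastHiY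 N) 1 ∧
      5 * (((fcellsV κ Φ t p O.merged (gOf κ Φ t p O gv) (fOf κ Φ t p O fv) (cOf κ Φ t p O gv fv cv) (hOf κ Φ t p O gv fv hv))).r 1 : ℤ) ≤ Skelφ.rdLo ((prFA κ Φ t p O.merged (gOf κ Φ t p O gv) (fOf κ Φ t p O fv))).A (nL κ Φ t p O.merged (gOf κ Φ t p O gv) (fOf κ Φ t p O fv)) (hL κ Φ t p O.merged (gOf κ Φ t p O gv) (fOf κ Φ t p O fv)) (vL κ Φ t p O.merged (gOf κ Φ t p O gv) (fOf κ Φ t p O fv)) (vβL κ Φ t p O.merged (gOf κ Φ t p O gv) (fOf κ Φ t p O fv)) ((prFA κ Φ t p O.merged (gOf κ Φ t p O gv) (fOf κ Φ t p O fv))).c₀ ((prFA κ Φ t p O.merged (gOf κ Φ t p O gv) (fOf κ Φ t p O fv))).c₁ ((prFA κ Φ t p O.merged (gOf κ Φ t p O gv) (fOf κ Φ t p O fv))).D (HK.kgLastLoY N) (HK.kgLastHiY N) 1 ∧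
      Skelφ.rdHi ((prFA κ Φ t p O.merged (gOf κ Φ t p O gv) (fOf κ Φ t p O fv))).A (nL κ Φ t p O.merged (gOf κ Φ t p O gv) (fOf κ Φ t p O fv)) (hL κ Φ t p O.merged (gOf κ Φ t p O gv) (fOf κ Φ t p O fv)) (vL κ Φ t p O.merged (gOf κ Φ t p O gv) (fOf κ Φ t p O fv)) (vβL κ Φ t p O.merged (gOf κ Φ t p O gv) (fOf κ Φ t p O fv)) ((prFA κ Φ t p O.merged (gOf κ Φ t p O gv) (fOf κ Φ t p O fv))).c₀ ((prFA κ Φ t p O.merged (gOf κ Φ t p O gv) (fOf κ Φ t p O fv))).c₁ ((prFA κ Φ t p O.merged (gOf κ Φ t p O gv) (fOf κ Φ t p O fv))).D (HK.kgLastLoY N) (HK.kgLastHiY N) 1 ≤ 20 * (((fcellsV κ Φ t p O.merged (gOf κ Φ t p O gv) (fOf κ Φ t p O fv) (cOf κ Φ t p O gv fv cv) (hOf κ Φ t p O gv fv hv))).r 1 : ℤ) + (bOf κ Φ t p O gv fv bv) 1 - 1 ∧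
      Skelφ.rdHi ((prFA κ Φ t p O.merged (gOf κ Φ t p O gv) (fOf κ Φ t p O fv))).A (nL κ Φ t p O.merged (gOf κ Φ t p O gv) (fOf κ Φ t p O fv)) (hL κ Φ t p O.merged (gOf κ Φ t p O gv) (fOf κ Φ t p O fv)) (vL κ Φ t p O.merged (gOf κ Φ t p O gv) (fOf κ Φ t p O fv)) (vβL κ Φ t p O.merged (gOf κ Φ t p O gv) (fOf κ Φ t p O fv)) ((prFA κ Φ t p O.merged (gOf κ Φ t p O gv) (fOf κ Φ t p O fv))).c₀ ((prFA κ Φ t p O.merged (gOf κ Φ t p O gv) (fOf κ Φ t p O fv))).c₁ ((prFA κ Φ t p O.merged (gOf κ Φ t p O gv) (fOf κ Φ t p O fv))).D (HK.kgLastLoY N) (HK.kgLastHiY N) 1 ≤ 22 * (((fcellsV κ Φ t p O.merged (gOf κ Φ t p O gv) (fOf κ Φ t p O fv) (cOf κ Φ t p O gv fv cv) (hOf κ Φ t p O gv fv hv))).r 1 : ℤ))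
    (hLt : ((fcellsV κ Φ t p O.merged (gOf κ Φ t p O gv) (fOf κ Φ t p O fv) (cOf κ Φ t p O gv fv cv) (hOf κ Φ t p O gv fv hv))).cenS (tgt e + stepVec ((((1 : Fin 2), true) : MDir))) 0 - ((fcellsV κ Φ t p O.merged (gOf κ Φ t p O gv) (fOf κ Φ t p O fv) (cOf κ Φ t p O gv fv cv) (hOf κ Φ t p O gv fv hv))).cenS (tgt e) 0 - (bOf κ Φ t p O gv fv bv) 0 + 1 ≤ Skelφ.rdLo ((prFA κ Φ t p O.merged (gOf κ Φ t p O gv) (fOf κ Φ t p O fv))).A (nL κ Φ t p O.merged (gOf κ Φ t p O gv) (fOf κ Φ t p O fv)) (hL κ Φ t p O.merged (gOf κ Φ t p O gv) (fOf κ Φ t p O fv)) (vL κ Φ t p O.merged (gOf κ Φ t p O gv) (fOf κ Φ t p O fv)) (vβL κ Φ t p O.merged (gOf κ Φ t p O gv) (fOf κ Φ t p O fv)) ((prFA κ Φ t p O.merged (gOf κ Φ t p O gv) (fOf κ Φ t p O fv))).c₀ ((prFA κ Φ t p O.merged (gOf κ Φ t p O gv) (fOf κ Φ t p O fv))).c₁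 ((prFA κ Φ t p O.merged (gOf κ Φ t p O gv) (fOf κ Φ t p O fv))).D (HK.kgLastLoY N) (HK.kgLastHiY N) 0 ∧
      Skelφ.rdHi ((prFA κ Φ t p O.merged (gOf κ Φ t p O gv) (fOf κ Φ t p O fv))).A (nL κ Φ t p O.merged (gOf κ Φ t p O gv) (fOf κ Φ t p O fv)) (hL κ Φ t p O.merged (gOf κ Φ t p O gv) (fOf κ Φ t p O fv)) (vL κ Φ t p O.merged (gOf κ Φ t p O gv) (fOf κ Φ t p O fv)) (vβL κ Φ t p O.merged (gOf κ Φ t p O gv) (fOf κ Φ t p O fv)) ((prFA κ Φ t p O.merged (gOf κ Φ t p O gv) (fOf κ Φ t p O fv))).c₀ ((prFA κ Φ t p O.merged (gOf κ Φ t p O gv) (fOf κ Φ t p O fv))).c₁ ((prFA κ Φ t p O.merged (gOf κ Φ t p O gv) (fOf κ Φ t p O fv))).D (HK.kgLastLoY N) (HK.kgLastHiY N) 0 ≤ ((fcellsV κ Φ t p O.merged (gOf κ Φ t p O gv) (fOf κ Φ t p O fv) (cOf κ Φ t p O gv fv cv) (hOf κ Φ t p O gv fv hv))).cenS (tgt e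 + stepVec ((((1 : Fin 2), true) : MDir))) 0 - ((fcellsV κ Φ t p O.merged (gOf κ Φ t p O gv) (fOf κ Φ t p O fv) (cOf κ Φ t p O gv fv cv) (hOf κ Φ t p O gv fv hv))).cenS (tgt e) 0 + (bOf κ Φ t p O gv fv bv) 0 - 1 ∧
      -(((fcellsV κ Φ t p O.merged (gOf κ Φ t p O gv) (fOf κ Φ t p O fv) (cOf κ Φ t p O gv fv cv) (hOf κ Φ t p O gv fv hv))).hB 1 : ℤ) ≤ Skelφ.rdLo ((prFA κ Φ t p O.merged (gOf κ Φ t p O gv) (fOf κ Φ t p O fv))).A (nL κ Φ t p O.merged (gOf κ Φ t p O gv) (fOf κ Φ t p O fv)) (hL κ Φ t p O.merged (gOf κ Φ t p O gv) (fOf κ Φ t p O fv)) (vL κ Φ t p O.merged (gOf κ Φ t p O gv) (fOf κ Φ t p O fv)) (vβL κ Φ t p O.merged (gOf κ Φ t p O gv) (fOf κ Φ t p O fv)) ((prFA κ Φ t p O.merged (gOf κ Φ t p O gv) (fOf κ Φ t p O fv))).c₀ ((prFA κ Φ t p O.merged (gOf κ Φ t p O gv) (fOf κ Φ t p O fv))).c₁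 ((prFA κ Φ t p O.merged (gOf κ Φ t p O gv) (fOf κ Φ t p O fv))).D (HK.kgLastLoY N) (HK.kgLastHiY N) 0 ∧
      Skelφ.rdHi ((prFA κ Φ t p O.merged (gOf κ Φ t p O gv) (fOf κ Φ t p O fv))).A (nL κ Φ t p O.merged (gOf κ Φ t p O gv) (fOf κ Φ t p O fv)) (hL κ Φ t p O.merged (gOf κ Φ t p O gv) (fOf κ Φ t p O fv)) (vL κ Φ t p O.merged (gOf κ Φ t p O gv) (fOf κ Φ t p O fv)) (vβL κ Φ t p O.merged (gOf κ Φ t p O gv) (fOf κ Φ t p O fv)) ((prFA κ Φ t p O.merged (gOf κ Φ t p O gv) (fOf κ Φ t p O fv))).c₀ ((prFA κ Φ t p O.merged (gOf κ Φ t p O gv) (fOf κ Φ t p O fv))).c₁ ((prFA κ Φ t p O.merged (gOf κ Φ t p O gv) (fOf κ Φ t p O fv))).D (HK.kgLastLoY N) (HK.kgLastHiY N) 0 ≤ (((fcellsV κ Φ t p O.merged (gOf κ Φ t p O gv) (fOf κ Φ t p O fv) (cOf κ Φ t p O gv fv cv) (hOf κ Φ t p O gv fv hv))).hF 1 : ℤ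))
    -- START-BOX ROWS (`aW ≤ (n ± v) + W`, `bL ≤ qq`)
    {aW Bx bL : ℤ} (ha : ((prFA κ Φ t p O.merged (gOf κ Φ t p O gv) (fOf κ Φ t p O fv))).D * (((prFA κ Φ t p O.merged (gOf κ Φ t p O gv) (fOf κ Φ t p O fv))).c₁ * ((nL κ Φ t p O.merged (gOf κ Φ t p O gv) (fOf κ Φ t p O fv)) : ℤ) * ((bOf κ Φ t p O gv fv bv) 0 + 1) + ((prFA κ Φ t p O.merged (gOf κ Φ t p O gv) (fOf κ Φ t p O fv))).c₀ * |(vL κ Φ t p O.merged (gOf κ Φ t p O gv) (fOf κ Φ t p O fv))| * ((bOf κ Φ t p O gv fv bv) 1 + 1)) ≤ ((prFA κ Φ t p O.merged (gOf κ Φ t p O gv) (fOf κ Φ t p O fv))).c₀ * ((prFA κ Φ t p O.merged (gOf κ Φ t p O gv) (fOf κ Φ t p O fv))).c₁ * ((prFA κ Φ t p O.merged (gOf κ Φ t p O gv) (fOf κ Φ t p O fv))).A * modulus (nL κ Φ t p O.merged (gOf κ Φ t p O gv) (fOf κ Φ t p O fv)) (hL κ Φ t p O.merged (gOf κ Φ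 t p O gv) (fOf κ Φ t p O fv)) (vL κ Φ t p O.merged (gOf κ Φ t p O gv) (fOf κ Φ t p O fv)) (vβL κ Φ t p O.merged (gOf κ Φ t p O gv) (fOf κ Φ t p O fv)) * aW)
    (hBx : ((prFA κ Φ t p O.merged (gOf κ Φ t p O gv) (fOf κ Φ t p O fv))).D * (((bOf κ Φ t p O gv fv bv) 1 : ℤ) + 1) ≤ ((prFA κ Φ t p O.merged (gOf κ Φ t p O gv) (fOf κ Φ t p O fv))).c₁ * ((prFA κ Φ t p O.merged (gOf κ Φ t p O gv) (fOf κ Φ t p O fv))).A * Bx) (hbL : Bx / (Skelφ.shearUnit (nL κ Φ t p O.merged (gOf κ Φ t p O gv) (fOf κ Φ t p O fv)) (hL κ Φ t p O.merged (gOf κ Φ t p O gv) (fOf κ Φ t p O fv)) : ℤ) + 1 ≤ bL)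
    (haW : aW ≤ (((((nL κ Φ t p O.merged (gOf κ Φ t p O gv) (fOf κ Φ t p O fv)) : ℤ) + (vL κ Φ t p O.merged (gOf κ Φ t p O gv) (fOf κ Φ t p O fv))).toNat + W : ℕ) : ℤ)) (haW' : aW ≤ (((((nL κ Φ t p O.merged (gOf κ Φ t p O gv) (fOf κ Φ t p O fv)) : ℤ) - (vL κ Φ t p O.merged (gOf κ Φ t p O gv) (fOf κ Φ t p O fv))).toNat + W : ℕ) : ℤ)) (hbq : bL ≤ qq)
    -- the budget
    {nmax : ℕ} (hnmax : (Skelφ.kgCorrSchedYU HK.hn HK.hv HK.hlay (HK.kgYVals_ok₁ N) (HK.kgYVals_ok₂ N) (HK.kgYVals_split N)).N ≤ nmax) :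
    ReachOblAtHNF G nmax ((KSchA.mk (ΓQV κ Φ t p O gv fv (SUS ex mx) cv hv bv q) q κ.δ : KSchA V ℕ)) (FDQV κ Φ t p O gv fv (SUS ex mx) cv hv q) Φ.Δ (κ.δr 0) h e ((((KSchA.mk (ΓQV κ Φ t p O gv fv (SUS ex mx) cv hv bv q) q κ.δ : KSchA V ℕ))).aOf₂O G h e) ((((1 : Fin 2), true) : MDir)) := by
  obtain ⟨ω, n, rfl⟩ := hrun
  -- the long clause and its numerics
  have hN := eqNumL_of_atQV (atQ3V_of_atQ3VPx hAt)
  obtain ⟨hn1, hℓ1⟩ := one_le_of_eqNumL κ Φ t p O.merged (gOf κ Φ t p O gv) (fOf κ Φ t p O fv) hN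
  have hκL := (clauseL_of_atQV (atQ3V_of_atQ3VPx hAt)).2
  obtain ⟨-, -, -, hCq⟩ := factsNS_of_atQV (atQ3V_of_atQ3VPx hAt)
  have hlipφ := lip_φL κ Φ t p O.D O.DT.toDataN O.ori (gOf κ Φ t p O gv) (fOf κ Φ t p O fv)
  have hstep := steps_φL κ Φ t p O.D O.DT.toDataN O.ori (gOf κ Φ t p O gv) (fOf κ Φ t p O fv)
  have hlipψ : Skelφ.Lip G (fineOA κ Φ t p O.D O.DT.toDataN O.ori (gOf κ Φ t p O gv) (fOf κ Φ t p O fv)) := lip_fineA_at κ Φ t p O.merged (gOf κ Φ t p O gv) (fOf κ Φ t p O fv) hlipφ hN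
  have hwsψ : Skelφ.WeakSteps G (fineOA κ Φ t p O.D O.DT.toDataN O.ori (gOf κ Φ t p O gv) (fOf κ Φ t p O fv)) := weakSteps_fineA_at κ Φ t p O.merged (gOf κ Φ t p O gv) (fOf κ Φ t p O fv) hstep hN
  have hψ0 : (fineOA κ Φ t p O.D O.DT.toDataN O.ori (gOf κ Φ t p O gv) (fOf κ Φ t p O fv)) t = 0 := fineA_base_at κ Φ t p O.merged (gOf κ Φ t p O gv) (fOf κ Φ t p O fv) _ hN
  have hΛ : Skelφ.WFS2 ((fcellsV κ Φ t p O.merged (gOf κ Φ t p O gv) (fOf κ Φ t p O fv) (cOf κ Φ t p O gv fv cv) (hOf κ Φ t p O gv fv hv))).toPCells2 (schedOfT κ Φ t p O.merged (gOf κ Φ t p O gv) (fOf κ Φ t p O fv) (cOf κ Φ t p O gv fv cv) (SUS ex mx κ Φ t p O.merged (gOf κ Φ t p O gv) (fOf κ Φ t p O fv) q)) := schedOfT_WFS2 κ Φ t p O.merged (gOf κ Φ t p O gv) (fOf κ Φ t p O fv) (cOf κ Φ t p O gv fv cv) (SUS ex mx κ Φ t p O.merged (gOf κ Φ t p O gv)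 (fOf κ Φ t p O fv) q)
  have hcolQ : ∀ a x, ∃ y ∈ Skelφ.VWin G (fineOA κ Φ t p O.D O.DT.toDataN O.ori (gOf κ Φ t p O gv) (fOf κ Φ t p O fv)) t (((fcellsV κ Φ t p O.merged (gOf κ Φ t p O gv) (fOf κ Φ t p O fv) (cOf κ Φ t p O gv fv cv) (hOf κ Φ t p O gv fv hv))).Q x) (((schedOfT κ Φ t p O.merged (gOf κ Φ t p O gv) (fOf κ Φ t p O fv) (cOf κ Φ t p O gv fv cv) (SUS ex mx κ Φ t p O.merged (gOf κ Φ t p O gv) (fOf κ Φ t p O fv) q))).rQ a x), (fineOA κ Φ t p O.D O.DT.toDataN O.ori (gOf κ Φ t p O gv) (fOf κ Φ t p O fv)) y = ((fcellsV κ Φ t p O.merged (gOf κ Φ t p O gv) (fOf κ Φ t p O fv) (cOf κ Φ t p O gv fv cv) (hOf κ Φ t p O gv fv hv))).cenS x :=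
    hcol_fineA_of_schedV κ Φ t p O.merged (gOf κ Φ t p O gv) (fOf κ Φ t p O fv) (cOf κ Φ t p O gv fv cv) (hOf κ Φ t p O gv fv hv) hlipφ hstep hN (colQ_schedOfT κ Φ t p O.merged (gOf κ Φ t p O gv) (fOf κ Φ t p O fv) (cOf κ Φ t p O gv fv cv) (SUS ex mx κ Φ t p O.merged (gOf κ Φ t p O gv) (fOf κ Φ t p O fv) q))
  have hgap := hgap20_US κ Φ t p O.merged (gOf κ Φ t p O gv) (fOf κ Φ t p O fv) ex mx q
  have hgapc := hgapc_US κ Φ t p O.merged (gOf κ Φ t p O gv) (fOf κ Φ t p O fv) ex mx q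
  have hgapL := hgapL_US κ Φ t p O.merged (gOf κ Φ t p O gv) (fOf κ Φ t p O fv) ex mx q
  have hoff := offNT_le κ Φ t p O.merged (gOf κ Φ t p O gv) (fOf κ Φ t p O fv) (cOf κ Φ t p O gv fv cv) hN hκL
  have hE3 := (three_le_E₀_US κ Φ t p O.merged (gOf κ Φ t p O gv) (fOf κ Φ t p O fv) ex mx q).1
  have hc' : (((((KSchA.mk (ΓQV κ Φ t p O gv fv (SUS ex mx) cv hv bv q) q κ.δ : KSchA V ℕ))).scheme₂O G).ostN KSchA.qNE n ω).ochoice KSchA.qNE = some e := by rw [KSchA.stN_eq₂O]; exact hc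
  -- THE RADII AT THE PROBE (realised anchors)
  obtain ⟨hrQ, hrB, hρ, -, hrM, hQS, hxn⟩ := Skelφ.reach_radii_concSG₂NbV (ψ := (fineOA κ Φ t p O.D O.DT.toDataN O.ori (gOf κ Φ t p O gv) (fOf κ Φ t p O fv))) (P := (fcellsV κ Φ t p O.merged (gOf κ Φ t p O gv) (fOf κ Φ t p O fv) (cOf κ Φ t p O gv fv cv) (hOf κ Φ t p O gv fv hv))) (t := t) (gap := Skelφ.Prm.gap (SUS ex mx κ Φ t p O.merged (gOf κ Φ t p O gv) (fOf κ Φ t p O fv) q)) (gap' := fun _ => 0)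
    (E₀ := Skelφ.Prm.E₀ (SUS ex mx κ Φ t p O.merged (gOf κ Φ t p O gv) (fOf κ Φ t p O fv) q)) (L' := Skelφ.Prm.Lp (SUS ex mx κ Φ t p O.merged (gOf κ Φ t p O gv) (fOf κ Φ t p O fv) q)) (off := offNT κ Φ t p O.merged (gOf κ Φ t p O gv) (fOf κ Φ t p O fv) (cOf κ Φ t p O gv fv cv)) (b₀ := (bOf κ Φ t p O gv fv bv)) (q := q) (δc := κ.δ)
    hgap hgapc hoff (by omega) hψ0 hc hV hdu
  obtain ⟨hDQ, hDρ', hρM, hlin⟩ := Skelφ.reach_radius_rows_concSG₂NbV (ψ := (fineOA κ Φ t p O.D O.DT.toDataN O.ori (gOf κ Φ t p O gv) (fOf κ Φ t p O fv))) (P := (fcellsV κ Φ t p O.merged (gOf κ Φ t p O gv) (fOf κ Φ t p O fv) (cOf κ Φ t p O gv fv cv) (hOf κ Φ t p O gv fv hv))) (t := t) (gap := Skelφ.Prm.gap (SUS ex mx κ Φ t p O.merged (gOf κ Φ t p O gv) (fOf κ Φ t p O fv) q))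
    (E₀ := Skelφ.Prm.E₀ (SUS ex mx κ Φ t p O.merged (gOf κ Φ t p O gv) (fOf κ Φ t p O fv) q)) (L' := Skelφ.Prm.Lp (SUS ex mx κ Φ t p O.merged (gOf κ Φ t p O gv) (fOf κ Φ t p O fv) q)) (off := offNT κ Φ t p O.merged (gOf κ Φ t p O gv) (fOf κ Φ t p O fv) (cOf κ Φ t p O gv fv cv)) (b₀ := (bOf κ Φ t p O gv fv bv)) (q := q) (δc := κ.δ)
    hgap hgapc hgapL hoff hE3 hψ0 hc hV hdu
  -- THE ENTRANCE DEPTH ALONG THE RUN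
  have hdeep := Skelφ.deep_of_run₂bOV hlipψ hwsψ (fcellsV κ Φ t p O.merged (gOf κ Φ t p O gv) (fOf κ Φ t p O fv) (cOf κ Φ t p O gv fv cv) (hOf κ Φ t p O gv fv hv)) t (Skelφ.Prm.gap (SUS ex mx κ Φ t p O.merged (gOf κ Φ t p O gv) (fOf κ Φ t p O fv) q)) (fun _ => 0) (Skelφ.Prm.E₀ (SUS ex mx κ Φ t p O.merged (gOf κ Φ t p O gv) (fOf κ Φ t p O fv) q)) (Skelφ.Prm.Lp (SUS ex mx κ Φ t p O.merged (gOf κ Φ t p O gv) (fOf κ Φ t p O fv) q))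
    (offNT κ Φ t p O.merged (gOf κ Φ t p O gv) (fOf κ Φ t p O fv) (cOf κ Φ t p O gv fv cv)) q κ.δ (bOf κ Φ t p O gv fv bv) hΛ hψ0 hgap hgapc hoff (by omega) hcolQ ω n hc' hdu ((((KSchA.mk (ΓQV κ Φ t p O gv fv (SUS ex mx) cv hv bv q) q κ.δ : KSchA V ℕ))).aOf₂O G ((((KSchA.mk (ΓQV κ Φ t p O gv fv (SUS ex mx) cv hv bv q) q κ.δ : KSchA V ℕ))).hst₂O G ω n) e)
  -- the levels, and the radii facts in the scheme-of-record form (definitional unfoldings of `ΓQV`/`schedOfT`/`FDQV`)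
  set E := Erad (Skelφ.Prm.gap (SUS ex mx κ Φ t p O.merged (gOf κ Φ t p O gv) (fOf κ Φ t p O fv) q)) (fun _ => 0) (Skelφ.Prm.E₀ (SUS ex mx κ Φ t p O.merged (gOf κ Φ t p O gv) (fOf κ Φ t p O fv) q)) (nQ ((((KSchA.mk (ΓQV κ Φ t p O gv fv (SUS ex mx) cv hv bv q) q κ.δ : KSchA V ℕ))).aOf₁O G ((((KSchA.mk (ΓQV κ Φ t p O gv fv (SUS ex mx) cv hv bv q) q κ.δ : KSchA V ℕ))).hst₂O G ω n) e) (tgt e)) with hEdef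
  set E' := Erad (Skelφ.Prm.gap (SUS ex mx κ Φ t p O.merged (gOf κ Φ t p O gv) (fOf κ Φ t p O fv) q)) (fun _ => 0) (Skelφ.Prm.E₀ (SUS ex mx κ Φ t p O.merged (gOf κ Φ t p O gv) (fOf κ Φ t p O fv) q)) (nS ((((KSchA.mk (ΓQV κ Φ t p O gv fv (SUS ex mx) cv hv bv q) q κ.δ : KSchA V ℕ))).aOf₁O G ((((KSchA.mk (ΓQV κ Φ t p O gv fv (SUS ex mx) cv hv bv q) q κ.δ : KSchA V ℕ))).hst₂O G ω n) e) e.1) with hE'def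
  have hEE₀ : Skelφ.Prm.E₀ (SUS ex mx κ Φ t p O.merged (gOf κ Φ t p O gv) (fOf κ Φ t p O fv) q) ≤ E := Skel.E₀_le_Erad _ _ _ _
  have hE'E₀ : Skelφ.Prm.E₀ (SUS ex mx κ Φ t p O.merged (gOf κ Φ t p O gv) (fOf κ Φ t p O fv) q) ≤ E' := Skel.E₀_le_Erad _ _ _ _
  have hrQ' : ((schedOfT κ Φ t p O.merged (gOf κ Φ t p O gv) (fOf κ Φ t p O fv) (cOf κ Φ t p O gv fv cv) (SUS ex mx κ Φ t p O.merged (gOf κ Φ t p O gv) (fOf κ Φ t p O fv) q))).rQ ((((KSchA.mk (ΓQV κ Φ t p O gv fv (SUS ex mx) cv hv bv q) q κ.δ : KSchA V ℕ))).aOf₁O G ((((KSchA.mk (ΓQV κ Φ t p O gv fv (SUS ex mx) cv hv bv q) q κ.δ : KSchA V ℕ))).hst₂O G ω n) e) (tgt e) = E := hrQ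
  have hrB' : ((schedOfT κ Φ t p O.merged (gOf κ Φ t p O gv) (fOf κ Φ t p O fv) (cOf κ Φ t p O gv fv cv) (SUS ex mx κ Φ t p O.merged (gOf κ Φ t p O gv) (fOf κ Φ t p O fv) q))).rB ((((KSchA.mk (ΓQV κ Φ t p O gv fv (SUS ex mx) cv hv bv q) q κ.δ : KSchA V ℕ))).aOf₁O G ((((KSchA.mk (ΓQV κ Φ t p O gv fv (SUS ex mx) cv hv bv q) q κ.δ : KSchA V ℕ))).hst₂O G ω n) e) e.1 e.2 = E := hrB
  have hρ' : ∀ ℓ, ((schedOfT κ Φ t p O.merged (gOf κ Φ t p O gv) (fOf κ Φ t p O fv) (cOf κ Φ t p O gv fv cv) (SUS ex mx κ Φ t p O.merged (gOf κ Φ t p O gv) (fOf κ Φ t p O fv) q))).ρ ((((KSchA.mk (ΓQV κ Φ t p O gv fv (SUS ex mx) cv hv bv q) q κ.δ : KSchA V ℕ))).aOf₂O G ((((KSchA.mk (ΓQV κ Φ t p O gv fv (SUS ex mx) cv hv bv q) q κ.δ : KSchA V ℕ))).hst₂O G ω n) e) (tgt e) ((((1 : Fin 2), true) : MDir)) ℓ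 = E - 2 := hρ
  have hQS' : nQ ((((KSchA.mk (ΓQV κ Φ t p O gv fv (SUS ex mx) cv hv bv q) q κ.δ : KSchA V ℕ))).aOf₁O G ((((KSchA.mk (ΓQV κ Φ t p O gv fv (SUS ex mx) cv hv bv q) q κ.δ : KSchA V ℕ))).hst₂O G ω n) e) (tgt e) = nS ((((KSchA.mk (ΓQV κ Φ t p O gv fv (SUS ex mx) cv hv bv q) q κ.δ : KSchA V ℕ))).aOf₁O G ((((KSchA.mk (ΓQV κ Φ t p O gv fv (SUS ex mx) cv hv bv q) q κ.δ : KSchA V ℕ))).hst₂O G ω n) e) e.1 + 1 := hQS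
  have hlin' : Skelφ.Prm.E₀ (SUS ex mx κ Φ t p O.merged (gOf κ Φ t p O gv) (fOf κ Φ t p O fv) q) + cOffS κ Φ t p O.merged (gOf κ Φ t p O gv) (fOf κ Φ t p O fv) * (((tgt e) 0).natAbs + ((tgt e) 1).natAbs) ≤ E := hlin
  have hDQ' : E - 3 + 1 ≤ ((schedOfT κ Φ t p O.merged (gOf κ Φ t p O gv) (fOf κ Φ t p O fv) (cOf κ Φ t p O gv fv cv) (SUS ex mx κ Φ t p O.merged (gOf κ Φ t p O gv) (fOf κ Φ t p O fv) q))).rQ ((((KSchA.mk (ΓQV κ Φ t p O gv fv (SUS ex mx) cv hv bv q) q κ.δ : KSchA V ℕ))).aOf₁O G ((((KSchA.mk (ΓQV κ Φ t p O gv fv (SUS ex mx) cv hv bv q) q κ.δ : KSchA V ℕ))).hst₂O G ω n) e) (tgt e) := hDQ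
  have hDρ'' : ∀ ℓ, E - 3 + 1 ≤ ((schedOfT κ Φ t p O.merged (gOf κ Φ t p O gv) (fOf κ Φ t p O fv) (cOf κ Φ t p O gv fv cv) (SUS ex mx κ Φ t p O.merged (gOf κ Φ t p O gv) (fOf κ Φ t p O fv) q))).ρ ((((KSchA.mk (ΓQV κ Φ t p O gv fv (SUS ex mx) cv hv bv q) q κ.δ : KSchA V ℕ))).aOf₂O G ((((KSchA.mk (ΓQV κ Φ t p O gv fv (SUS ex mx) cv hv bv q) q κ.δ : KSchA V ℕ))).hst₂O G ω n) e) (tgt e) ((((1 : Fin 2), true) : MDir)) ℓ := hDρ'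
  have hρM' : ∀ ℓ, ((schedOfT κ Φ t p O.merged (gOf κ Φ t p O gv) (fOf κ Φ t p O fv) (cOf κ Φ t p O gv fv cv) (SUS ex mx κ Φ t p O.merged (gOf κ Φ t p O gv) (fOf κ Φ t p O fv) q))).ρ ((((KSchA.mk (ΓQV κ Φ t p O gv fv (SUS ex mx) cv hv bv q) q κ.δ : KSchA V ℕ))).aOf₂O G ((((KSchA.mk (ΓQV κ Φ t p O gv fv (SUS ex mx) cv hv bv q) q κ.δ : KSchA V ℕ))).hst₂O G ω n) e) (tgt e) ((((1 : Fin 2), true) : MDir)) ℓ + 1 ≤ ((schedOfT κ Φ t p O.merged (gOf κ Φ t p O gv) (fOf κ Φ t p O fv) (cOf κ Φ t p O gv fv cv) (SUS ex mx κ Φ t p O.merged (gOf κ Φ t p O gv) (fOf κ Φ t p O fv) q))).rM ((((KSchA.mk (ΓQV κ Φ t p O gv fv (SUS ex mx) cv hv bv q) q κ.δ : KSchA V ℕ))).aOf₂O G ((((KSchA.mk (ΓQV κ Φ t p O gv fv (SUS ex mx) cv hv bv q) q κ.δ : KSchA V ℕ))).hst₂O G ω n) e) (tgt e + stepVec ((((1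 : Fin 2), true) : MDir))) := hρM
  have hdeep' : ∀ a ∈ (((KSchA.mk (ΓQV κ Φ t p O gv fv (SUS ex mx) cv hv bv q) q κ.δ : KSchA V ℕ))).Vx G ((((KSchA.mk (ΓQV κ Φ t p O gv fv (SUS ex mx) cv hv bv q) q κ.δ : KSchA V ℕ))).hst₂O G ω n), ∀ b ∈ (((KSchA.mk (ΓQV κ Φ t p O gv fv (SUS ex mx) cv hv bv q) q κ.δ : KSchA V ℕ))).Γ.Ewv ((((KSchA.mk (ΓQV κ Φ t p O gv fv (SUS ex mx) cv hv bv q) q κ.δ : KSchA V ℕ))).aOf₁O G ((((KSchA.mk (ΓQV κ Φ t p O gv fv (SUS ex mx) cv hv bv q) q κ.δ : KSchA V ℕ))).hst₂O G ω n) e) e.1 e.2 ∪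
      ((FDQV κ Φ t p O gv fv (SUS ex mx) cv hv q)).Hfull ((((KSchA.mk (ΓQV κ Φ t p O gv fv (SUS ex mx) cv hv bv q) q κ.δ : KSchA V ℕ))).aOf₂O G ((((KSchA.mk (ΓQV κ Φ t p O gv fv (SUS ex mx) cv hv bv q) q κ.δ : KSchA V ℕ))).hst₂O G ω n) e) (tgt e) ((((1 : Fin 2), true) : MDir)), b ∉ (((KSchA.mk (ΓQV κ Φ t p O gv fv (SUS ex mx) cv hv bv q) q κ.δ : KSchA V ℕ))).Vx G ((((KSchA.mk (ΓQV κ Φ t p O gv fv (SUS ex mx) cv hv bv q) q κ.δ : KSchA V ℕ))).hst₂O G ω n) → G.Adj a b → a ∈ graphBall G t E' := hdeep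
  have hEsucc : E = E' + Skelφ.Prm.gap (SUS ex mx κ Φ t p O.merged (gOf κ Φ t p O gv) (fOf κ Φ t p O fv) q) E' := by
    rw [hEdef, hQS', BoxProdZ2.Erad_succ, BoxProdZ2.Frad_succ, ← hE'def]; simp
  have hρ3' : (SUS ex mx κ Φ t p O.merged (gOf κ Φ t p O gv) (fOf κ Φ t p O fv) q).Rex E' + KS0.r₀0 t Dk mk (RL κ Φ t p O gv fv + D) + 3 ≤ Skelφ.Prm.gap (SUS ex mx κ Φ t p O.merged (gOf κ Φ t p O gv) (fOf κ Φ t p O fv) q) E' := hρ3 _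
  -- the tolerance of the excess device
  have hη' : Neg.η κ Φ ≤ κ.δr 0 / 2 := by
    have h2 := (Neg.η_pos κ Φ).2.2
    have hk := Neg.δkit_le_δr κ Φ (n := 0) (by norm_num)
    linarith
  refine reachOblAtHNF_frmQ3VD_sndUPx hAt hP hp0 hp1 mk Dk hΛRgK hV hdu hne HK N (R := E - 3) ?_ hDQ' hDρ'' hρM' (R₀ := E') hdeep'
    hPR hLl hLt ha hBx hbL haW haW' hbq ?_
    (φe := (fineOA κ Φ t p O.D O.DT.toDataN O.ori (gOf κ Φ t p O gv) (fOf κ Φ t p O fv))) (Rw := E) (m' := 25 * ((fcellsV κ Φ t p O.merged (gOf κ Φ t p O gv) (fOf κ Φ t p O fv) (cOf κ Φ t p O gv fv cv) (hOf κ Φ t p O gv fv hv))).rmax) (m := 50 * (fcellsA κ Φ t p O.merged (gOf κ Φ t p O gv) (fOf κ Φ t p O fv)).rmax) (R₁ := (SUS ex mx κ Φ t p O.merged (gOf κ Φ t p O gv) (fOf κ Φ t p O fv) q).Rex E')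
    (ctr := ((fcellsV κ Φ t p O.merged (gOf κ Φ t p O gv) (fOf κ Φ t p O fv) (cOf κ Φ t p O gv fv cv) (hOf κ Φ t p O gv fv hv))).cenS (tgt e)) ?_ ?_ ?_ ?_ ?_ hnmax
  · -- hr₀R : r₀0 ≤ E − 3
    omega
  · -- hRD : (cOffS‖x‖₁ + 1) + 13·(box) ≤ E − 3
    set Zb : ℤ := (((N : ℤ) + 1) * (((nL κ Φ t p O.merged (gOf κ Φ t p O gv) (fOf κ Φ t p O fv)) * (ℓL κ Φ t p O.merged (gOf κ Φ t p O gv) (fOf κ Φ t p O fv)) / Skelφ.shearUnit (nL κ Φ t p O.merged (gOf κ Φ t p O gv) (fOf κ Φ t p O fv)) (hL κ Φ t p O.merged (gOf κ Φ t p O gv) (fOf κ Φ t p O fv)) + 1 : ℕ) : ℤ) + Skelφ.kgZY₀ (nL κ Φ t p O.merged (gOf κ Φ t p O gv) (fOf κ Φ t p O fv)) (vL κ Φ t p O.merged (gOf κ Φ t p O gv) (fOf κ Φ t p O fv)) (KS0.R'0 κ Φ t p Dk mk) ρ W N (Skelφ.kgM₁Y (nL κ Φ t p O.merged (gOf κ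 Φ t p O gv) (fOf κ Φ t p O fv)) (vL κ Φ t p O.merged (gOf κ Φ t p O gv) (fOf κ Φ t p O fv)) (KS0.R'0 κ Φ t p Dk mk) ρ W N) (Skelφ.kgWm₂Y (nL κ Φ t p O.merged (gOf κ Φ t p O gv) (fOf κ Φ t p O fv)) (vL κ Φ t p O.merged (gOf κ Φ t p O gv) (fOf κ Φ t p O fv)) (KS0.R'0 κ Φ t p Dk mk) ρ W N) (Skelφ.kgWp₂Y (nL κ Φ t p O.merged (gOf κ Φ t p O gv) (fOf κ Φ t p O fv)) (vL κ Φ t p O.merged (gOf κ Φ t p O gv) (fOf κ Φ t p O fv)) (KS0.R'0 κ Φ t p Dk mk) ρ W N) (Skelφ.kgM₂Y (nL κ Φ t p O.merged (gOf κ Φ t p O gv) (fOf κ Φ t p O fv)) (ℓL κ Φ t p O.merged (gOf κ Φ t p O gv) (fOf κ Φ t p O fv)) (hL κ Φ t p O.merged (gOf κ Φ t p O gv) (fOf κ Φ t p O fv)) (vL κ Φ t p O.merged (gOf κ Φ t p O gv) (fOf κ Φ t p O fv)) (KS0.R'0 κ Φ t p Dk mk) ρ qq W N) + Skelφ.kgZY₁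 (nL κ Φ t p O.merged (gOf κ Φ t p O gv) (fOf κ Φ t p O fv)) (ℓL κ Φ t p O.merged (gOf κ Φ t p O gv) (fOf κ Φ t p O fv)) (hL κ Φ t p O.merged (gOf κ Φ t p O gv) (fOf κ Φ t p O fv)) (KS0.R'0 κ Φ t p Dk mk) ρ qq N (Skelφ.kgM₁Y (nL κ Φ t p O.merged (gOf κ Φ t p O gv) (fOf κ Φ t p O fv)) (vL κ Φ t p O.merged (gOf κ Φ t p O gv) (fOf κ Φ t p O fv)) (KS0.R'0 κ Φ t p Dk mk) ρ W N) (Skelφ.kgM₂Y (nL κ Φ t p O.merged (gOf κ Φ t p O gv) (fOf κ Φ t p O fv)) (ℓL κ Φ t p O.merged (gOf κ Φ t p O gv) (fOf κ Φ t p O fv)) (hL κ Φ t p O.merged (gOf κ Φ t p O gv) (fOf κ Φ t p O fv)) (vL κ Φ t p O.merged (gOf κ Φ t p O gv) (fOf κ Φ t p O fv)) (KS0.R'0 κ Φ t p Dk mk) ρ qq W N)) with hZb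
    have hcast : (((E - 3 : ℕ)) : ℤ) = (E : ℤ) - 3 := by omega
    rw [hcast]
    have hlinZ : ((Skelφ.Prm.E₀ (SUS ex mx κ Φ t p O.merged (gOf κ Φ t p O gv) (fOf κ Φ t p O fv) q) : ℕ) : ℤ) + ((cOffS κ Φ t p O.merged (gOf κ Φ t p O gv) (fOf κ Φ t p O fv) * (((tgt e) 0).natAbs + ((tgt e) 1).natAbs) + 1 : ℕ) : ℤ) ≤ (E : ℤ) + 1 := by
      have := hlin'; push_cast at this ⊢; linarith
    linarith [hρ2, hlinZ]
  · -- hWπ : the world lies in `B(t, E)`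
    intro b hb
    exact Skelφ.mem_graphBall_of_mem_Ewv_Hfull₂bV (le_of_eq hrB') (le_of_eq hrQ') (fun ℓ => (le_of_eq (hρ' ℓ)).trans (Nat.sub_le _ _)) hb
  · -- hWpl : planar footprints in `cenS x + Λ_(25·rmax)`
    intro b hb
    exact Skelφ.ψ_mem_box_image_of_mem_Ewv_Hfull₂bV hb
  · -- hm
    show 2 * (25 * (fcellsA κ Φ t p O.merged (gOf κ Φ t p O gv) (fOf κ Φ t p O fv)).rmax) ≤ 50 * (fcellsA κ Φ t p O.merged (gOf κ Φ t p O gv) (fOf κ Φ t p O fv)).rmax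
    omega
  · -- hR₁ : the excess device at entrance depth `E' + 1`, fine-map diameter `50·rmax`
    intro R'' hR'' Rw' D' A' hD' hdiam hAD hA
    exact hR₁_US κ Φ t p O.merged (gOf κ Φ t p O gv) (fOf κ Φ t p O fv) ex mx q hCq (oL κ Φ t p O.D O.DT.toDataN O.ori (gOf κ Φ t p O gv) (fOf κ Φ t p O fv)) hη' t E' R'' hR'' Rw' D' A' hD'
      (fun d hd d' hd' => fine_diam_le_mRS κ Φ t p O.merged (gOf κ Φ t p O gv) (fOf κ Φ t p O fv) (mx κ Φ t p O.merged (gOf κ Φ t p O gv) (fOf κ Φ t p O fv)) hN (hdiam d hd d' hd')) hAD hA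
  · -- hR₁R : Rex E' ≤ (E − 3) − r₀0  (one gap absorbs the excess)
    omega

end Rad

end NegB

end PlanarSkeletonFrmFrom

end Summit.CriticalPhenomena.PercolationContinuityZ3.Theorems.Transplant

end
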